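import Literature.Topology.FourManifolds.LatticeFormsPullbackSignature
import HarnessLib

/-!
# The index of a lattice and of a sublattice: finite index, and codimension one with an isotropic
radical vector

J.-P. Serre, *A Course in Arithmetic* (GTM 7, 1973), Ch. V §1.3.2 (the index `τ = r - s` of a
lattice is that of the real form `E ⊗ 𝐑`) and Ch. IV §1.3–§1.4 (orthogonal splitting off a
nondegenerate, e.g. hyperbolic, plane).  Two consequences, over `ℤ` and for the tree's
`LinearMap.BilinForm.signature = b⁺ - b⁻` (Mathlib's `sigPos`, `sigNeg`), with no nondegeneracy
or freeness hypotheses: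

* `LinearMap.BilinForm.signature_eq_of_comp_of_finiteIndex` — **a map `f : W → V` compatible
  with the forms whose range has finite index does not change the index** (`τ(B) = τ(B')` for
  `B = B' ∘ (f × f)`, every element of `V` having a nonzero multiple in `range f`): positive
  definite sublattices of `V` have nonzero multiples inside `range f`, which lift;
* `LinearMap.BilinForm.signature_eq_of_isotropic_radical` — **codimension one with an isotropic
  radical vector**: if moreover `B'` is symmetric, `range f + ℤt` has finite index in `V` for
  some `t`, and some `s ∈ W` lies in the radical of `B` while `B' (f s) t ≠ 0`, then again
  `τ(B) = τ(B')`.  Proof: up to finite index `W = s^{⊥t} ⊕ ℤ s` and `W × ℤ ↠ V` with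
  `V = s^{⊥t} ⊕ ⟨f s, t⟩` up to finite index, where `s^{⊥t} = {x | B' (f x) t = 0}`; the form is
  `B|_{s^{⊥t}} ⊕ 0` on the first and `B|_{s^{⊥t}} ⊕ (hyperbolic-type plane [[0, d], [d, e]])` on
  the second, and both extra summands have index `0`.

This is the algebra of the invariance of the signature under a surgery on a `(p-1)`-sphere in a
`2p`-manifold (Kervaire–Milnor 1963, §5–§7; Kosinski 1993, X.3.3): there `Hᵖ` before and after
the surgery are compared inside one lattice in which the old one is a finite-index quotient image
and the new one contains it with corank `≤ 1`, the extra class being dual to the cocore sphere.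

Everything is proved; no definitions, no named facts.

## References

* J.-P. Serre, *A Course in Arithmetic*, GTM 7, Springer 1973, Ch. IV §1.3–§1.4, Ch. V §1.3.2.
  [Serre1973]
* J. Milnor, D. Husemoller, *Symmetric bilinear forms*, Springer 1973, Ch. I §3, Ch. II §2.
  [MilnorHusemoller1973]
* M. Kervaire, J. Milnor, *Groups of homotopy spheres I*, Ann. of Math. 77 (1963), §5–§7.
  [KervaireMilnorAnnals1963]
-/

noncomputable section

open Module Function

namespace LinearMap.BilinForm

universe u v w

section Ordered

variable {R : Type u} [CommRing R] [LinearOrder R] [IsStrictOrderedRing R]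
variable {V : Type v} {W : Type w} [AddCommGroup V] [Module R V] [AddCommGroup W] [Module R W]

/-- **Lifting a positive definite family through a compatible map** (compare
`le_sigPos_of_comp_surjective_of_linearIndependent`): if `B' (f x) (f y) = B x y` and a linearly
independent family `v` of a positive definite submodule `P ⊆ V` lies in `range f`, then
`#v ≤ b⁺(B)` (lift the family; it stays independent, `f` is injective on its span, so the
pulled-back form is positive definite there). [cite: Serre1973, Ch. IV §1.2–§1.4] -/
theorem le_sigPos_of_comp_of_linearIndependent_mem_range [Module.Finite R W]
    (B : LinearMap.BilinForm R W) (B' : LinearMap.BilinForm R V) (f : W →ₗ[R] V)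
    (hφ : ∀ x y, B' (f x) (f y) = B x y)
    {P : Submodule R V} (hpos : (B'.toQuadraticMap.restrict P).PosDef)
    {r : ℕ} (v : Fin r → P) (hv : LinearIndependent R v) (hvr : ∀ i, (v i : V) ∈ LinearMap.range f) :
    r ≤ sigPos B.toQuadraticMap := by
  classical
  choose w hw using fun i => LinearMap.mem_range.1 (hvr i)
  have hw_ind : LinearIndependent R w := by
    refine LinearIndependent.of_comp f ?_
    have : (f ∘ w) = fun i => ((v i : P) : V) := funext fun i => hw i
    rw [this]
    exact hv.map' P.subtype (Submodule.ker_subtype P)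
  set Q : Submodule R W := Submodule.span R (Set.range w) with hQ
  have hφQ : ∀ x ∈ Q, f x ∈ P := by
    intro x hx
    refine Submodule.span_induction (p := fun x _ => f x ∈ P) ?_ ?_ ?_ ?_ hx
    · rintro _ ⟨i, rfl⟩; rw [hw]; exact (v i).2
    · rw [map_zero]; exact P.zero_mem
    · intro x y _ _ hx hy; rw [map_add]; exact P.add_mem hx hy
    · intro a x _ hx; rw [map_smul]; exact P.smul_mem a hx
  have hinjQ : ∀ x ∈ Q, f x = 0 → x = 0 := by
    intro x hx hx0
    obtain ⟨c, rfl⟩ := (Finsupp.mem_span_range_iff_exists_finsupp).1 hx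
    have h1 : (Finsupp.linearCombination R (fun i => ((v i : P) : V))) c = 0 := by
      rw [Finsupp.linearCombination_apply] at ⊢
      rw [Finsupp.sum] at hx0 ⊢
      rw [map_sum] at hx0
      simpa only [map_smul, hw] using hx0
    have hind : LinearIndependent R (fun i => ((v i : P) : V)) :=
      hv.map' P.subtype (Submodule.ker_subtype P)
    have hc : c = 0 := (linearIndependent_iff.1 hind) c h1
    simp [hc]
  have hposQ : (B.toQuadraticMap.restrict Q).PosDef := by
    intro x hx
    have hxP : f (x : W) ∈ P := hφQ x x.2
    have hne : (⟨f (x : W), hxP⟩ : P) ≠ 0 := by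
      intro h0
      apply hx
      have : f (x : W) = 0 := congrArg Subtype.val h0
      exact Subtype.ext (hinjQ x x.2 this)
    have h1 : 0 < B'.toQuadraticMap (f (x : W)) := hpos ⟨f (x : W), hxP⟩ hne
    change 0 < B.toQuadraticMap (x : W)
    rw [LinearMap.BilinMap.toQuadraticMap_apply, ← hφ]
    rwa [LinearMap.BilinMap.toQuadraticMap_apply] at h1
  have hrank : r ≤ finrank R Q := by
    have hwQ : ∀ i, w i ∈ Q := fun i => Submodule.subset_span (Set.mem_range_self i)
    haveI : Module.Finite R Q := Module.Finite.span_of_finite R (Set.finite_range w)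
    let w' : Fin r → Q := fun i => ⟨w i, hwQ i⟩
    have hw'_ind : LinearIndependent R w' :=
      LinearIndependent.of_comp Q.subtype (by exact hw_ind)
    simpa using hw'_ind.fintype_card_le_finrank
  exact hrank.trans (le_sigPos_of_posDef _ hposQ)

end Ordered

/-! ### Over `ℤ`: finite index -/

section Int

variable {V : Type v} {W : Type w} [AddCommGroup V] [AddCommGroup W]

/-- A positive definite submodule of a `ℤ`-lattice is torsion-free: scaling by `N ≠ 0` is
injective on it, so it preserves linear independence of families in it. [folklore] -/
theorem linearIndependent_smul_of_posDef (B' : LinearMap.BilinForm ℤ V)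
    {P : Submodule ℤ V} (hpos : (B'.toQuadraticMap.restrict P).PosDef) {r : ℕ} {u : Fin r → P}
    (hu : LinearIndependent ℤ u) {N : ℤ} (hN : N ≠ 0) :
    LinearIndependent ℤ (fun i => N • u i) := by
  rw [linearIndependent_iff'] at hu ⊢
  intro s g hg i hi
  have h1 : N • (∑ j ∈ s, g j • u j) = 0 := by
    rw [Finset.smul_sum]
    simpa only [smul_comm N (g _) (u _)] using hg
  have h2 : (∑ j ∈ s, g j • u j) = 0 := by
    by_contra hne
    have hp : 0 < B'.toQuadraticMap ((∑ j ∈ s, g j • u j : P) : V) := hpos _ hne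
    have : B'.toQuadraticMap ((N • ∑ j ∈ s, g j • u j : P) : V) = 0 := by
      rw [h1]; simp
    rw [Submodule.coe_smul, QuadraticMap.map_smul, smul_eq_mul] at this
    rcases mul_eq_zero.1 this with h | h
    · exact hN (pow_eq_zero_iff two_ne_zero |>.1 (by simpa [sq] using h))
    · exact (ne_of_gt hp) h
  exact hu s g h2 i hi

/-- **Finite index does not change the index** (Serre 1973, Ch. V §1.3.2: `τ` is read off
`E ⊗ 𝐑`): for `f : W → V` with `B' (f x) (f y) = B x y` such that every `v ∈ V` has a nonzero
multiple in `range f`, `τ(B) = τ(B')`.  `b±(B) ≤ b±(B')` is `sigPos_le_sigPos_of_comp`; conversely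
a positive definite `P ⊆ V` of rank `r` contains `r` independent vectors, a common nonzero
multiple of which lies in `range f`, still independent (`P` is torsion-free) and still in `P`.
Stated for arbitrary `Module ℤ` instances. [cite: Serre1973, Ch. V §1.3.2] -/
theorem signature_eq_of_comp_of_finiteIndex [instV : Module ℤ V] [instW : Module ℤ W]
    [Module.Finite ℤ V] [Module.Finite ℤ W]
    (B : LinearMap.BilinForm ℤ W) (B' : LinearMap.BilinForm ℤ V) (f : W →ₗ[ℤ] V)
    (hφ : ∀ x y, B' (f x) (f y) = B x y)
    (hfi : ∀ v : V, ∃ n : ℤ, n ≠ 0 ∧ n • v ∈ LinearMap.range f) :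
    B.signature = B'.signature := by
  obtain rfl : instV = AddCommGroup.toIntModule V := Subsingleton.elim _ _
  obtain rfl : instW = AddCommGroup.toIntModule W := Subsingleton.elim _ _
  -- `b⁺`
  have hpos : sigPos B.toQuadraticMap = sigPos B'.toQuadraticMap := by
    refine le_antisymm (sigPos_le_sigPos_of_comp B B' f hφ) ?_
    obtain ⟨P, hP, hposP⟩ := exists_finrank_eq_sigPos_and_posDef B'.toQuadraticMap
    rw [← hP]
    obtain ⟨u, hu⟩ := exists_linearIndependent_of_le_finrank (le_refl (finrank ℤ P))
    have hfi' := fun i => hfi (u i : V)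
    choose n hn hnr using hfi'
    set N : ℤ := ∏ i, n i with hNdef
    have hN : N ≠ 0 := Finset.prod_ne_zero_iff.2 fun i _ => hn i
    have hNr : ∀ i, ((N • u i : P) : V) ∈ LinearMap.range f := by
      intro i
      have hsplit : N = (∏ j ∈ Finset.univ.erase i, n j) * n i := by
        rw [hNdef, ← Finset.prod_erase_mul _ _ (Finset.mem_univ i)]
      rw [Submodule.coe_smul, hsplit, mul_smul]
      exact Submodule.smul_mem _ _ (hnr i)
    exact le_sigPos_of_comp_of_linearIndependent_mem_range B B' f hφ hposP (fun i => N • u i)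
      (linearIndependent_smul_of_posDef B' hposP hu hN) hNr
  -- `b⁻`: the same for `-B`, `-B'`
  have hneg : sigNeg B.toQuadraticMap = sigNeg B'.toQuadraticMap := by
    have hφ' : ∀ x y, (-B') (f x) (f y) = (-B) x y := fun x y => by
      simp only [LinearMap.neg_apply, hφ]
    have h1 : sigPos (-B).toQuadraticMap ≤ sigPos (-B').toQuadraticMap :=
      sigPos_le_sigPos_of_comp (-B) (-B') f hφ'
    have h2 : sigPos (-B').toQuadraticMap ≤ sigPos (-B).toQuadraticMap := by
      obtain ⟨P, hP, hposP⟩ := exists_finrank_eq_sigPos_and_posDef (-B').toQuadraticMap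
      rw [← hP]
      obtain ⟨u, hu⟩ := exists_linearIndependent_of_le_finrank (le_refl (finrank ℤ P))
      have hfi' := fun i => hfi (u i : V)
      choose n hn hnr using hfi'
      set N : ℤ := ∏ i, n i with hNdef
      have hN : N ≠ 0 := Finset.prod_ne_zero_iff.2 fun i _ => hn i
      have hNr : ∀ i, ((N • u i : P) : V) ∈ LinearMap.range f := by
        intro i
        have hsplit : N = (∏ j ∈ Finset.univ.erase i, n j) * n i := by
          rw [hNdef, ← Finset.prod_erase_mul _ _ (Finset.mem_univ i)]
        rw [Submodule.coe_smul, hsplit, mul_smul]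
        exact Submodule.smul_mem _ _ (hnr i)
      exact le_sigPos_of_comp_of_linearIndependent_mem_range (-B) (-B') f hφ' hposP
        (fun i => N • u i) (linearIndependent_smul_of_posDef (-B') hposP hu hN) hNr
    have h := le_antisymm h1 h2
    rwa [show (-B).toQuadraticMap = -B.toQuadraticMap from rfl,
      show (-B').toQuadraticMap = -B'.toQuadraticMap from rfl, sigPos_neg, sigPos_neg] at h
  rw [signature, signature, hpos, hneg]

end Int

/-! ### Over `ℤ`: two planes of index zero -/

section Planes

/-- The zero form on `ℤ` has `b⁺ = 0`. [folklore] -/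
theorem sigPos_zero_int : sigPos (0 : LinearMap.BilinForm ℤ ℤ).toQuadraticMap = 0 := by
  obtain ⟨P, hP, hpos⟩ := exists_finrank_eq_sigPos_and_posDef (0 : LinearMap.BilinForm ℤ ℤ).toQuadraticMap
  rw [← hP]
  have : P = ⊥ := by
    rw [eq_bot_iff]
    intro x hx
    by_contra hne
    have h := hpos ⟨x, hx⟩ (by intro h0; apply hne; exact congrArg Subtype.val h0)
    exact absurd h (by simp)
  rw [this, finrank_bot]

/-- The zero form on `ℤ` has index `0`. [folklore] -/
theorem signature_zero_int : (0 : LinearMap.BilinForm ℤ ℤ).signature = 0 := by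
  rw [signature, show sigNeg (0 : LinearMap.BilinForm ℤ ℤ).toQuadraticMap =
    sigPos (0 : LinearMap.BilinForm ℤ ℤ).toQuadraticMap by
      rw [← sigPos_neg]; rfl, sigPos_zero_int]
  simp

/-- **The plane `[[0, d], [d, e]]`** on `ℤ × ℤ`: `((α, β), (α', β')) ↦ d (α β' + α' β) + e β β'`.
Defined inline through `LinearMap.mk₂`; no named definition. A vector of positive square:
`(d (|e| + 1), 1)`. [cite: Serre1973, Ch. IV §1.3 (hyperbolic plane)] -/
theorem exists_pos_and_neg_of_plane (d e : ℤ) (hd : d ≠ 0) :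
    let H : LinearMap.BilinForm ℤ (ℤ × ℤ) := LinearMap.mk₂ ℤ
      (fun p q => d * (p.1 * q.2 + q.1 * p.2) + e * (p.2 * q.2))
      (fun p p' q => by simp only [Prod.fst_add, Prod.snd_add]; ring)
      (fun c p q => by simp only [Prod.smul_fst, Prod.smul_snd, smul_eq_mul]; ring)
      (fun p q q' => by simp only [Prod.fst_add, Prod.snd_add]; ring)
      (fun c p q => by simp only [Prod.smul_fst, Prod.smul_snd, smul_eq_mul]; ring)
    (0 < H (d * (|e| + 1), 1) (d * (|e| + 1), 1)) ∧ (H (-(d * (|e| + 1)), 1) (-(d * (|e| + 1)), 1) < 0) := by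
  intro H
  have hd2 : 1 ≤ d * d := by nlinarith [sq_nonneg d, Int.one_le_abs hd, abs_mul_abs_self d]
  have he : -|e| ≤ e ∧ e ≤ |e| := ⟨neg_abs_le e, le_abs_self e⟩
  constructor
  · change 0 < d * (d * (|e| + 1) * 1 + d * (|e| + 1) * 1) + e * (1 * 1)
    nlinarith [abs_nonneg e]
  · change d * (-(d * (|e| + 1)) * 1 + -(d * (|e| + 1)) * 1) + e * (1 * 1) < 0
    nlinarith [abs_nonneg e]

/-- `1 ≤ b⁺` as soon as some vector has positive square (the line it spans is positive definite:
a vector of positive square is torsion-free). [cite: Serre1973, Ch. IV §1.2] -/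
theorem one_le_sigPos_of_pos {V : Type v} [AddCommGroup V] [Module.Finite ℤ V]
    (B : LinearMap.BilinForm ℤ V) {v : V} (hv : 0 < B v v) : 1 ≤ sigPos B.toQuadraticMap := by
  -- `a • v = 0` forces `a = 0`
  have htf : ∀ a : ℤ, a • v = 0 → a = 0 := by
    intro a ha
    by_contra ha0
    have h1 : B (a • v) (a • v) = 0 := by rw [ha]; simp
    simp only [map_smul, LinearMap.smul_apply, smul_eq_mul] at h1
    have : 0 < a * (a * B v v) := by
      have haa : 0 < a * a := mul_self_pos.2 ha0
      nlinarith
    exact (ne_of_gt this) h1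
  have hpos : (B.toQuadraticMap.restrict (Submodule.span ℤ {v})).PosDef := by
    intro x hx
    obtain ⟨a, ha⟩ := Submodule.mem_span_singleton.1 x.2
    have ha0 : a ≠ 0 := by
      rintro rfl; apply hx; apply Subtype.ext; simp [← ha]
    change 0 < B.toQuadraticMap (x : V)
    rw [← ha, QuadraticMap.map_smul, LinearMap.BilinMap.toQuadraticMap_apply, smul_eq_mul]
    exact mul_pos (mul_self_pos.2 ha0) hv
  -- the one-element family `⟨v⟩` of the line is linearly independent
  let u : Fin 1 → ↥(Submodule.span ℤ {v}) := fun _ => ⟨v, Submodule.mem_span_singleton_self v⟩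
  have hu : LinearIndependent ℤ u := by
    rw [Fintype.linearIndependent_iff]
    intro g hg i
    have h1 : g 0 • v = 0 := by
      have := congrArg Subtype.val hg
      simpa [u, Fin.sum_univ_one] using this
    obtain rfl : i = 0 := Subsingleton.elim _ _
    exact htf _ h1
  exact le_sigPos_of_comp_surjective_of_linearIndependent B B LinearMap.id (fun _ _ => rfl)
    surjective_id hpos u hu

/-- **A plane `[[0, d], [d, e]]` with `d ≠ 0` has index `0`** (`b⁺ = b⁻ = 1`: it has vectors of
both signs and rank `2`; Serre 1973, Ch. IV §1.3, the hyperbolic plane up to the diagonal entry).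
[cite: Serre1973, Ch. IV §1.3] -/
theorem signature_plane_eq_zero (d e : ℤ) (hd : d ≠ 0) (H : LinearMap.BilinForm ℤ (ℤ × ℤ))
    (hH : ∀ p q : ℤ × ℤ, H p q = d * (p.1 * q.2 + q.1 * p.2) + e * (p.2 * q.2)) :
    H.signature = 0 := by
  have h1 : 1 ≤ sigPos H.toQuadraticMap := by
    refine one_le_sigPos_of_pos H (v := (d * (|e| + 1), 1)) ?_
    rw [hH]
    have := (exists_pos_and_neg_of_plane d e hd).1
    simpa using this
  have h2 : 1 ≤ sigNeg H.toQuadraticMap := by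
    rw [← sigPos_neg, show -H.toQuadraticMap = (-H).toQuadraticMap from rfl]
    refine one_le_sigPos_of_pos (-H) (v := (-(d * (|e| + 1)), 1)) ?_
    rw [LinearMap.neg_apply, LinearMap.neg_apply, hH]
    have := (exists_pos_and_neg_of_plane d e hd).2
    simp only [neg_pos]
    simpa using this
  have h3 : sigPos H.toQuadraticMap + sigNeg H.toQuadraticMap ≤ 2 := by
    have := sigPos_add_sigNeg_le_finrank H.toQuadraticMap
    simpa using this
  rw [signature]; omega

end Planes

/-! ### Over `ℤ`: codimension one with an isotropic radical vector -/

section Radical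

variable {V : Type v} {W : Type w} [AddCommGroup V] [AddCommGroup W]

/-- **Codimension one with an isotropic radical vector** (Serre 1973, Ch. IV §1.3–§1.4 and
Ch. V §1.3.2; the algebra of a surgery on a `(p-1)`-sphere, Kervaire–Milnor 1963 §5–§7): let
`f : W → V` be compatible with the forms (`B' (f x) (f y) = B x y`), `B'` symmetric, `s ∈ W` in
the radical of `B`, `t ∈ V` with `B' (f s) t ≠ 0`, and suppose `range f + ℤ t` has finite index
in `V`.  Then `τ(B) = τ(B')`.  With `H₀ = {x | B' (f x) t = 0}`: `H₀ ⊕ ℤ s → W` and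
`H₀ ⊕ ℤ² → V`, `(h, α, β) ↦ f h + α f s + β t`, have finite-index ranges and pull the forms back
to `B|_{H₀} ⊕ 0` and `B|_{H₀} ⊕ [[0, d], [d, e]]` (`d = B' (f s) t`, `e = B' t t`), whose extra
summands have index `0`. [cite: Serre1973, Ch. IV §1.3–§1.4 and Ch. V §1.3.2] -/
theorem signature_eq_of_isotropic_radical [instV : Module ℤ V] [instW : Module ℤ W]
    [Module.Finite ℤ V] [Module.Finite ℤ W]
    (B : LinearMap.BilinForm ℤ W) (B' : LinearMap.BilinForm ℤ V) (hB' : B'.IsSymm)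
    (f : W →ₗ[ℤ] V) (hφ : ∀ x y, B' (f x) (f y) = B x y)
    (s : W) (hs : ∀ x, B s x = 0) (t : V) (hst : B' (f s) t ≠ 0)
    (hfi : ∀ v : V, ∃ n : ℤ, n ≠ 0 ∧ ∃ (x : W) (a : ℤ), n • v = f x + a • t) :
    B.signature = B'.signature := by
  obtain rfl : instV = AddCommGroup.toIntModule V := Subsingleton.elim _ _
  obtain rfl : instW = AddCommGroup.toIntModule W := Subsingleton.elim _ _
  have hsym : ∀ x y, B' x y = B' y x := LinearMap.BilinForm.isSymm_def.1 hB'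
  have hBsym : ∀ x y, B x y = B y x := fun x y => by rw [← hφ, hsym, hφ]
  have hs' : ∀ x, B x s = 0 := fun x => by rw [hBsym]; exact hs x
  set d : ℤ := B' (f s) t with hd
  set e : ℤ := B' t t with he
  have hts : B' t (f s) = d := by rw [hsym]
  -- `g x = B' (f x) t` and `H₀ = ker g`
  set g : W →ₗ[ℤ] ℤ := (B'.flip t) ∘ₗ f with hg
  have hg_apply : ∀ x, g x = B' (f x) t := fun x => rfl
  have hgs : g s = d := rfl
  set H₀ : Submodule ℤ W := LinearMap.ker g with hH₀
  have hmemH₀ : ∀ x, x ∈ H₀ ↔ B' (f x) t = 0 := fun x => LinearMap.mem_ker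
  haveI : Module.Finite ℤ ↥H₀ := Module.Finite.of_injective H₀.subtype Subtype.val_injective
  -- the restricted form and the plane
  set B₀ : LinearMap.BilinForm ℤ ↥H₀ := B.compl₁₂ H₀.subtype H₀.subtype with hB₀
  have hB₀sym : B₀.IsSymm := LinearMap.BilinForm.isSymm_def.2 fun x y => hBsym _ _
  let Hpl : LinearMap.BilinForm ℤ (ℤ × ℤ) := LinearMap.mk₂ ℤ
    (fun p q => d * (p.1 * q.2 + q.1 * p.2) + e * (p.2 * q.2))
    (fun p p' q => by simp only [Prod.fst_add, Prod.snd_add]; ring)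
    (fun c p q => by simp only [Prod.smul_fst, Prod.smul_snd, smul_eq_mul]; ring)
    (fun p q q' => by simp only [Prod.fst_add, Prod.snd_add]; ring)
    (fun c p q => by simp only [Prod.smul_fst, Prod.smul_snd, smul_eq_mul]; ring)
  have hHpl : ∀ p q : ℤ × ℤ, Hpl p q = d * (p.1 * q.2 + q.1 * p.2) + e * (p.2 * q.2) := fun p q => rfl
  have hHplsym : Hpl.IsSymm := LinearMap.BilinForm.isSymm_def.2 fun p q => by rw [hHpl, hHpl]; ring
  have h0sym : (0 : LinearMap.BilinForm ℤ ℤ).IsSymm := LinearMap.BilinForm.isSymm_def.2 fun _ _ => rfl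
  -- projection of `x` to `H₀` up to the factor `d`: `d • x - g x • s ∈ H₀`
  have hproj : ∀ x : W, d • x - g x • s ∈ H₀ := by
    intro x
    rw [hH₀, LinearMap.mem_ker, map_sub, map_smul, map_smul, smul_eq_mul, smul_eq_mul, hgs]
    ring
  -- Step W: `H₀ × ℤ → W`, `(h, b) ↦ h + b • s`
  let ΘW : ↥H₀ × ℤ →ₗ[ℤ] W := H₀.subtype.coprod (LinearMap.toSpanSingleton ℤ W s)
  have hΘW : ∀ p : ↥H₀ × ℤ, ΘW p = (p.1 : W) + p.2 • s := fun p => rfl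
  have finW : Module.Finite ℤ (↥H₀ × ℤ) := inferInstance
  have hφW : ∀ p q : ↥H₀ × ℤ, B (ΘW p) (ΘW q) = (B₀.prod (0 : LinearMap.BilinForm ℤ ℤ)) p q := by
    intro p q
    rw [hΘW, hΘW, prod_apply]
    simp only [map_add, map_smul, LinearMap.add_apply, LinearMap.smul_apply, smul_eq_mul, hs, hs',
      LinearMap.zero_apply, mul_zero, add_zero]
    rfl
  have hfiW : ∀ x : W, ∃ n : ℤ, n ≠ 0 ∧ n • x ∈ LinearMap.range ΘW := by
    intro x
    refine ⟨d, hst, ⟨(⟨d • x - g x • s, hproj x⟩, g x), ?_⟩⟩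
    rw [hΘW]; simp
  have eW : (B₀.prod (0 : LinearMap.BilinForm ℤ ℤ)).signature = B.signature :=
    signature_eq_of_comp_of_finiteIndex (B₀.prod (0 : LinearMap.BilinForm ℤ ℤ)) B ΘW hφW hfiW
  -- Step V: `H₀ × (ℤ × ℤ) → V`, `(h, α, β) ↦ f h + α • f s + β • t`
  let ΘV : ↥H₀ × (ℤ × ℤ) →ₗ[ℤ] V := (f ∘ₗ H₀.subtype).coprod
    ((LinearMap.toSpanSingleton ℤ V (f s)).coprod (LinearMap.toSpanSingleton ℤ V t))
  have hΘV : ∀ p : ↥H₀ × (ℤ × ℤ), ΘV p = f (p.1 : W) + (p.2.1 • f s + p.2.2 • t) := fun p => rfl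
  have eV : (B₀.prod Hpl).signature = B'.signature := by
    refine signature_eq_of_comp_of_finiteIndex (B₀.prod Hpl) B' ΘV (fun p q => ?_) (fun v => ?_)
    · have h1 : B' (f (p.1 : W)) t = 0 := (hmemH₀ _).1 p.1.2
      have h2 : B' (f (q.1 : W)) t = 0 := (hmemH₀ _).1 q.1.2
      have h1' : B' t (f (p.1 : W)) = 0 := by rw [hsym]; exact h1
      have h2' : B' t (f (q.1 : W)) = 0 := by rw [hsym]; exact h2
      rw [hΘV, hΘV, prod_apply, hHpl]
      simp only [map_add, map_smul, LinearMap.add_apply, LinearMap.smul_apply, smul_eq_mul, hφ,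
        hs, hs', h1, h2', hts, ← hd, ← he, mul_zero, add_zero, zero_add]
      simp only [hB₀, LinearMap.compl₁₂_apply, Submodule.coe_subtype]
      ring
    · obtain ⟨n, hn, x, a, hv⟩ := hfi v
      refine ⟨d * n, mul_ne_zero hst hn, ⟨(⟨d • x - g x • s, hproj x⟩, (g x, d * a)), ?_⟩⟩
      rw [hΘV]
      conv_rhs => rw [mul_smul, hv]
      simp only [smul_add, map_sub, map_smul, mul_smul]
      abel
  -- conclude
  rw [← eW, ← eV, signature_prod B₀ 0 hB₀sym h0sym, signature_prod B₀ Hpl hB₀sym hHplsym,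
    signature_zero_int, signature_plane_eq_zero d e hst Hpl hHpl]

end Radical

end LinearMap.BilinForm
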